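import Literature.NumberTheory.Transcendental.KZCubePolynomialKernel
import Literature.NumberTheory.Transcendental.KZMellinFibres
import Literature.NumberTheory.Transcendental.KZDominatedFamilyRelations

/-!
# `NormalFormPrinciple` (stmt-KontsevichZagierPeriods-3869), line `SketchIdeator1` — the leaf
# `stub_boxRigidity` on an explicit all-dimension family, I: UNICOORDINATE DENOMINATORS REDUCE TO
# DIMENSION ONE

Support file (siege attempt k2, "explicit / elementary route") for the conjecture-grade stub
`stub_boxRigidity` of `Cruxes/NormalFormPrinciple/Lines/SketchIdeator1.lean` (BoxRigidity: two
representations on open unit boxes `(0,1)ᵐ`, `(0,1)ᵐ'` with integrands of KZ's rational shape and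
equal values are KZ-equivalent — Conjecture 1 of Kontsevich–Zagier frozen to boxes; by
`Theorems/…PiBoxTransfer.lean` it sits between the summit and `KZ.PiLocalKernel`, so it is not
provable outright). This file is the ENGINE of an all-dimension layer of the stub, proving the
registered sub-goal `boxUnicoord_reduce`: every box-rational representation whose denominator is a
polynomial in ONE coordinate, `[(0,1)ᵐ, p(x)/q(xᵢ)]` (`p ∈ ℚ[x₀,…,x_{m−1}]`, `q ∈ ℚ[X]`
non-vanishing on `[0,1]`), differs by KZ relations from a dimension-one representation
`[(0,1), p₁(x₀)/q(x₀)]` with THE SAME denominator — the format consumed by the dimension-one layers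
of the leaf (`box_split_mem_relations`, `box_algsplit_mem_relations`, …); the companion file
`…BoxUnicoordRigidityK2.lean` turns dimension-one vanishing theorems for a class of denominators
into the stub on the corresponding all-dimension family (unconditionally for polynomial
integrands). Elementary and explicit:

* `of_sub_of_rep_mem_relations` — the open box `(0,1)ᵐ` and the closed cube `[0,1]ᵐ` of a regular
  rational function (`KZ.RFun`, `KZCubeRational.lean`) differ by the null faces (rule 1a);
* `exists_integrateOut` — **integrating out the variables the denominator does not see**: a
  regular rational function on `[0,1]^{M+k}` whose denominator is a polynomial in the first `M`
  variables is congruent modulo `KZ.relations` to one on `[0,1]^M` with the same denominator — `k`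
  Newton–Leibniz moves along the last coordinate (Ayoub's Stokes relation `KZ.RFun.stokes`) with the
  rational primitives `P̂/q`, `∂_last P̂ = p` (`KZ.exists_pderiv_eq`), regular on the closed cube;
  this generalises `KZ.RFun.rel_lift` (`p` free of the last variable) and the reduction behind the
  polynomial kernel `KZ.RFun.poly_rep_mem_relations_of_integral_eq_zero` (`q = 1`);
* `exists_reduce_unicoord` — a coordinate permutation (rule 2, `KZ.RFun.rel_rename`) puts the
  distinguished coordinate first, so `[[0,1]ᵐ, p(x)/q(xᵢ)] ≡ [[0,1], p'(x)/q(x)]`;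
* `boxUnicoord_reduce` — back to the open interval (rule 1a) in the vocabulary of the stub.

Pure proof file (theorems only, no new definitions). References: M. Kontsevich, D. Zagier,
*Periods* (2001), §1.2 [cite: KontsevichZagier2001, §1.2]; J. Ayoub, *Periods and the conjectures
of Grothendieck and Kontsevich–Zagier*, EMS Newsl. 91 (2014), Def. 10 [cite: Ayoub2014, Def. 10].
-/

noncomputable section

open MeasureTheory Set MvPolynomial
open Literature.NumberTheory.Transcendental Literature.NumberTheory.Transcendental.KZ
open Literature.ModelTheory.ExponentialFields (IsSemialgebraic)

namespace Summit.KontsevichZagierPeriods.HurwitzMicroSectors.NormalFormPrinciple.PiBox.Unicoord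

variable {M m : ℕ}

/-! ## 1. The open box and the closed cube of a regular rational function -/

/-- The open unit box lies in the closed unit cube. [folklore] -/
theorem box_subset_cube (n : ℕ) : {x : Fin n → ℝ | ∀ i, x i ∈ Set.Ioo (0:ℝ) 1} ⊆ KZ.cube n :=
  fun _ hx i => ⟨(hx i).1.le, (hx i).2.le⟩

/-- The closed unit cube exceeds the open unit box by a Lebesgue-null set (the faces `xᵢ = 0`,
`xᵢ = 1`). [folklore] -/
theorem volume_cube_diff_box (n : ℕ) :
    volume (KZ.cube n \ {x : Fin n → ℝ | ∀ i, x i ∈ Set.Ioo (0:ℝ) 1}) = 0 := by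
  have hsub : KZ.cube n \ {x : Fin n → ℝ | ∀ i, x i ∈ Set.Ioo (0:ℝ) 1} ⊆
      ⋃ i : Fin n, ({x : Fin n → ℝ | x i = 0} ∪ {x | x i = 1}) := by
    rintro x ⟨hx, hx'⟩
    simp only [mem_setOf_eq, mem_Ioo, not_forall] at hx'
    obtain ⟨i, hi⟩ := hx'
    refine mem_iUnion.2 ⟨i, ?_⟩
    have h0 := KZ.mem_cube.1 hx i
    rcases not_and_or.mp hi with h | h
    · exact Or.inl (le_antisymm (not_lt.mp h) h0.1)
    · exact Or.inr (le_antisymm h0.2 (not_lt.mp h))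
  refine measure_mono_null hsub (measure_iUnion_null fun i => ?_)
  rw [measure_union_null_iff, volume_pi]
  exact ⟨Measure.pi_hyperplane _ i 0, Measure.pi_hyperplane _ i 1⟩

/-- **Open box versus closed cube.** A representation on the open unit box `(0,1)ᵐ` whose integrand
agrees there with a regular rational function `T` differs from the cube representation
`[[0,1]ᵐ, T]` by relations: restrict the cube to the box (rule 1a), the faces are null), then
congruence of integrands (rule 1b)). [cite: KontsevichZagier2001, §1.2 rule (1)] -/
theorem of_sub_of_rep_mem_relations (N : IntegralRep m)
    (hNd : N.domain = {x | ∀ i, x i ∈ Set.Ioo (0:ℝ) 1}) (T : RFun m)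
    (h : EqOn N.integrand T.fn {x | ∀ i, x i ∈ Set.Ioo (0:ℝ) 1}) :
    KZ.of N - KZ.of T.rep ∈ KZ.relations := by
  have hsub : {x : Fin m → ℝ | ∀ i, x i ∈ Set.Ioo (0:ℝ) 1} ⊆ T.rep.domain := by
    rw [RFun.rep_domain]; exact box_subset_cube m
  have h1 := KZ.IntegralRep.of_sub_of_restrict_mem_relations T.rep (isSemialgebraic_box m) hsub
    (by rw [RFun.rep_domain]; exact volume_cube_diff_box m)
  have h2 : KZ.of N - KZ.of (T.rep.restrict _ (isSemialgebraic_box m) hsub) ∈ KZ.relations :=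
    of_sub_of_mem_relations_of_eqOn (by rw [IntegralRep.domain_restrict, hNd])
      (by rw [hNd]; exact h)
  have e : KZ.of N - KZ.of T.rep =
      (KZ.of N - KZ.of (T.rep.restrict _ (isSemialgebraic_box m) hsub)) -
        (KZ.of T.rep - KZ.of (T.rep.restrict _ (isSemialgebraic_box m) hsub)) := by abel
  rw [e]
  exact KZ.relations.sub_mem h2 h1

/-! ## 2. Integrating out the variables the denominator does not see -/

/-- A polynomial in the first `M` variables has no last-variable derivative in `M + k + 1`
variables. [folklore] -/
theorem pderiv_last_rename_castAdd (q : MvPolynomial (Fin M) ℚ) (k : ℕ) :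
    pderiv (Fin.last (M + k)) (rename (Fin.castAdd (k + 1)) q) = 0 := by
  refine pderiv_eq_zero_of_notMem_vars fun h => ?_
  obtain ⟨i, -, hi⟩ := mem_vars_rename _ _ h
  have := congrArg Fin.val hi
  simp only [Fin.val_castAdd, Fin.val_last] at this
  omega

/-- Substituting a constant for the last variable does not touch a polynomial in the first `M`
variables. [folklore] -/
theorem bind₁_faceSubst_rename_castAdd (q : MvPolynomial (Fin M) ℚ) (k : ℕ) (c : ℚ) :
    bind₁ (RFun.faceSubst (M + k) c) (rename (Fin.castAdd (k + 1)) q) =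
      rename (Fin.castAdd k) q := by
  rw [bind₁_rename]
  have hfun : (RFun.faceSubst (M + k) c ∘ Fin.castAdd (k + 1) : Fin M → MvPolynomial (Fin (M + k)) ℚ) =
      X ∘ Fin.castAdd k := by
    funext i
    show RFun.faceSubst (M + k) c (Fin.castSucc (Fin.castAdd k i)) = X (Fin.castAdd k i)
    simp [RFun.faceSubst]
  rw [hfun, ← aeval_eq_bind₁, ← rename_eq_aeval]

/-- **One Newton–Leibniz move integrates out the last variable when the denominator does not see
it**: for `T = p/den` on `[0,1]^{M+k+1}` with `den` a polynomial in the first `M` variables,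
`[T] ≡ [S]` with `S = (P̂(·,1) − P̂(·,0))/den` on `[0,1]^{M+k}`, `∂_last P̂ = p` — Ayoub's Stokes
relation for the regular primitive `P̂/den`, whose last-variable derivative is `T` because
`∂_last den = 0`, and whose two faces have the same denominator.
[cite: Ayoub2014, Def. 10] -/
theorem exists_integrateOut_step (q : MvPolynomial (Fin M) ℚ) (k : ℕ) (T : RFun (M + k + 1))
    (hT : T.den = rename (Fin.castAdd (k + 1)) q) :
    ∃ S : RFun (M + k), S.den = rename (Fin.castAdd k) q ∧
      KZ.of T.rep - KZ.of S.rep ∈ KZ.relations := by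
  obtain ⟨G₀, hG₀⟩ := exists_pderiv_eq (Fin.last (M + k)) T.num
  set G : RFun (M + k + 1) := ⟨G₀, T.den, T.den_ne⟩ with hG
  have hst := RFun.stokes G
  set F1 : RFun (M + k) := G.face 1 ⟨zero_le_one, le_rfl⟩ with hF1
  set F0 : RFun (M + k) := G.face 0 ⟨le_rfl, zero_le_one⟩ with hF0
  have hF1d : F1.den = rename (Fin.castAdd k) q := by
    show bind₁ _ T.den = _
    rw [hT, bind₁_faceSubst_rename_castAdd]
  have hF0d : F0.den = rename (Fin.castAdd k) q := by
    show bind₁ _ T.den = _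
    rw [hT, bind₁_faceSubst_rename_castAdd]
  -- the derivative of the primitive is `T`
  have e1 : KZ.of T.rep - KZ.of G.dlast.rep ∈ KZ.relations := by
    refine RFun.rel_of_eqOn fun x hx => ?_
    have hden : (aeval x T.den : ℝ) ≠ 0 := T.den_ne x hx
    have hpd : pderiv (Fin.last (M + k)) T.den = 0 := by
      rw [hT]; exact pderiv_last_rename_castAdd q k
    simp only [RFun.fn, hG, RFun.dlast, hG₀, hpd, mul_zero, sub_zero, map_mul, map_pow]
    field_simp
  -- the two faces share the denominator, so their difference is one regular rational function
  set S : RFun (M + k) := ⟨F1.num - F0.num, F1.den, F1.den_ne⟩ with hS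
  have e2 : KZ.of (F1.sub F0).rep - KZ.of S.rep ∈ KZ.relations := by
    refine RFun.rel_of_eqOn fun x hx => ?_
    rw [RFun.fn_sub hx]
    simp only [RFun.fn, hS, map_sub, hF1d, hF0d]
    rw [sub_div]
  have e3 := RFun.rel_sub F1 F0
  refine ⟨S, hF1d, ?_⟩
  have e : KZ.of T.rep - KZ.of S.rep =
      (KZ.of T.rep - KZ.of G.dlast.rep) +
      (KZ.of G.dlast.rep - (KZ.of F1.rep - KZ.of F0.rep)) -
      (KZ.of (F1.sub F0).rep - (KZ.of F1.rep - KZ.of F0.rep)) +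
      (KZ.of (F1.sub F0).rep - KZ.of S.rep) := by abel
  rw [e]
  exact KZ.relations.add_mem (KZ.relations.sub_mem (KZ.relations.add_mem e1 hst) e3) e2

/-- **Integrating out the variables the denominator does not see.** A regular rational function on
`[0,1]^{M+k}` whose denominator is a polynomial `q` in the first `M` variables is congruent modulo
`KZ.relations` to a regular rational function `p/q` on `[0,1]^M` with the same denominator
(`k` Newton–Leibniz moves, `exists_integrateOut_step`). For `q = 1` this is the reduction behind the
polynomial kernel `KZ.RFun.poly_rep_mem_relations_of_integral_eq_zero`; for `p` free of the last
variables it is `KZ.RFun.rel_liftN`. [cite: KontsevichZagier2001, §1.2 rule (3)] -/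
theorem exists_integrateOut (q : MvPolynomial (Fin M) ℚ) (hq : ∀ x ∈ KZ.cube M, aeval x q ≠ 0) :
    ∀ (k : ℕ) (T : RFun (M + k)), T.den = rename (Fin.castAdd k) q →
      ∃ p : MvPolynomial (Fin M) ℚ, KZ.of T.rep - KZ.of (⟨p, q, hq⟩ : RFun M).rep ∈ KZ.relations
  | 0, T, hT => by
    refine ⟨T.num, RFun.rel_of_eqOn fun x _ => ?_⟩
    simp only [RFun.fn, hT, aeval_rename]
    rfl
  | k + 1, T, hT => by
    obtain ⟨S, hS, hTS⟩ := exists_integrateOut_step q k T hT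
    obtain ⟨p, hp⟩ := exists_integrateOut q hq k S hS
    refine ⟨p, ?_⟩
    have e : KZ.of T.rep - KZ.of (⟨p, q, hq⟩ : RFun M).rep =
        (KZ.of T.rep - KZ.of S.rep) + (KZ.of S.rep - KZ.of (⟨p, q, hq⟩ : RFun M).rep) := by abel
    rw [e]
    exact KZ.relations.add_mem hTS hp

/-! ## 3. Unicoordinate denominators reduce to dimension one -/

/-- A univariate polynomial regular on `[0,1]`, read in the coordinate `x₀` of `ℝ¹`, is regular on
the closed unit cube of `ℝ¹`. [folklore] -/
theorem den_ne_toMvPolynomial_zero (q : Polynomial ℚ)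
    (hq : ∀ t ∈ Set.Icc (0:ℝ) 1, Polynomial.aeval t q ≠ 0) :
    ∀ x ∈ KZ.cube 1, aeval x (q.toMvPolynomial (0 : Fin 1)) ≠ 0 := fun x hx => by
  rw [aeval_toMvPolynomial]
  exact hq (x 0) ⟨(KZ.mem_cube.1 hx 0).1, (KZ.mem_cube.1 hx 0).2⟩

/-- **Unicoordinate denominators reduce to dimension one.** A regular rational function
`p(x)/q(xᵢ)` on `[0,1]ᵐ` whose denominator is a univariate polynomial in one coordinate is
congruent modulo `KZ.relations` to `p'(x)/q(x)` on `[0,1]` for some `p' ∈ ℚ[x]`: move the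
coordinate `i` to the front (rule 2, `KZ.RFun.rel_rename`) and integrate out the other `m − 1`
variables (`exists_integrateOut`). [cite: KontsevichZagier2001, §1.2 rules (2), (3)] -/
theorem exists_reduce_unicoord (i : Fin m) (q : Polynomial ℚ)
    (hq : ∀ t ∈ Set.Icc (0:ℝ) 1, Polynomial.aeval t q ≠ 0) (T : RFun m)
    (hT : T.den = q.toMvPolynomial i) :
    ∃ p : MvPolynomial (Fin 1) ℚ,
      KZ.of T.rep - KZ.of (⟨p, q.toMvPolynomial 0, den_ne_toMvPolynomial_zero q hq⟩ : RFun 1).rep ∈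
        KZ.relations := by
  cases m with
  | zero => exact i.elim0
  | succ n =>
    set e : Fin (n + 1) ≃ Fin (1 + n) := (Equiv.swap i 0).trans (finCongr (Nat.add_comm n 1))
      with he_def
    have hei : e i = Fin.castAdd n (0 : Fin 1) := by
      apply Fin.ext
      simp [he_def, Equiv.swap_apply_left]
    have h1 := RFun.rel_rename T e
    have hden : (T.rename e).den = rename (Fin.castAdd n) (q.toMvPolynomial (0 : Fin 1)) := by
      show rename e T.den = _
      rw [hT, rename_toMvPolynomial, rename_toMvPolynomial, hei]
    obtain ⟨p, hp⟩ := exists_integrateOut (M := 1) (q.toMvPolynomial 0)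
      (den_ne_toMvPolynomial_zero q hq) n (T.rename e) hden
    refine ⟨p, ?_⟩
    have e' : KZ.of T.rep -
        KZ.of (⟨p, q.toMvPolynomial 0, den_ne_toMvPolynomial_zero q hq⟩ : RFun 1).rep =
        (KZ.of T.rep - KZ.of (T.rename e).rep) + (KZ.of (T.rename e).rep -
          KZ.of (⟨p, q.toMvPolynomial 0, den_ne_toMvPolynomial_zero q hq⟩ : RFun 1).rep) := by
      abel
    rw [e']
    exact KZ.relations.add_mem h1 hp

/-! ### Back to the open box: the statement in the vocabulary of the stub -/

/-- Every `ℚ`-polynomial in the single variable `x₀` of `ℝ¹` is a univariate polynomial read in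
`x₀`. [folklore] -/
theorem exists_eq_toMvPolynomial (P : MvPolynomial (Fin 1) ℚ) :
    ∃ p : Polynomial ℚ, P = p.toMvPolynomial 0 := by
  refine ⟨aeval (fun _ : Fin 1 => (Polynomial.X : Polynomial ℚ)) P, ?_⟩
  have h : (Polynomial.toMvPolynomial (0 : Fin 1)).comp
      (aeval (fun _ : Fin 1 => (Polynomial.X : Polynomial ℚ))) = AlgHom.id ℚ _ := by
    refine MvPolynomial.algHom_ext fun i => ?_
    obtain rfl : i = 0 := Subsingleton.elim _ _
    rw [AlgHom.comp_apply, aeval_X, Polynomial.toMvPolynomial_X, AlgHom.id_apply]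
  exact (AlgHom.congr_fun h P).symm

/-- In `ℝ¹` the open unit box is the open unit interval in the coordinate `x₀`. [folklore] -/
theorem box_one_eq :
    {x : Fin 1 → ℝ | ∀ i, x i ∈ Set.Ioo (0:ℝ) 1} = {x | x 0 ∈ Set.Ioo (0:ℝ) 1} := by
  ext x
  simp only [mem_setOf_eq, Fin.forall_fin_one]

/-- **Unicoordinate box-rational representations reduce to dimension one (registered sub-goal
`boxUnicoord_reduce` of stmt-KontsevichZagierPeriods-3869).** A representation on the open unit box
`(0,1)ᵐ` (any `m ≥ 1`) whose integrand is `p(x)/q(xᵢ)` — `p ∈ ℚ[x₀,…,x_{m−1}]`, `q ∈ ℚ[X]`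
non-vanishing on `[0,1]`, read in ONE coordinate `xᵢ` — differs by KZ relations from a
representation on the open unit interval `{x | x₀ ∈ (0,1)}` with integrand `p₁(x₀)/q(x₀)` for some
`p₁ ∈ ℚ[X]` and THE SAME denominator `q`: glue to the cube (rule 1a), `exists_reduce_unicoord`
(rules 2 and 3), and restrict the cube `[0,1]` back to the open interval (rule 1a). This is the
format consumed by the dimension-one layers of the leaf (`box_split_mem_relations`, …).
[cite: KontsevichZagier2001, §1.2] -/
theorem boxUnicoord_reduce {m : ℕ} (i : Fin m) (p : MvPolynomial (Fin m) ℚ) (q : Polynomial ℚ) (hq : ∀ t ∈ Set.Icc (0:ℝ) 1, (Polynomial.aeval t q : ℝ) ≠ 0) (N : IntegralRep m) (hNd : N.domain = {x | ∀ i, x i ∈ Set.Ioo (0:ℝ) 1}) (hNi : EqOn N.integrand (fun x => (MvPolynomial.aeval x p : ℝ) / Polynomial.aeval (x i) q) N.domain) : ∃ (p₁ : Polynomial ℚ) (N₁ : IntegralRep 1), N₁.domain = {x | x 0 ∈ Set.Ioo (0:ℝ) 1} ∧ EqOn N₁.integrand (fun x => (Polynomial.aeval (x 0) p₁ : ℝ)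 / Polynomial.aeval (x 0) q) N₁.domain ∧ of N - of N₁ ∈ relations := by
  -- glue to the cube representation of `p/q(xᵢ)`
  set T : RFun m := ⟨p, q.toMvPolynomial i, fun x hx => by
    rw [aeval_toMvPolynomial]; exact hq (x i) ⟨(KZ.mem_cube.1 hx i).1, (KZ.mem_cube.1 hx i).2⟩⟩
    with hT
  have g1 : KZ.of N - KZ.of T.rep ∈ KZ.relations :=
    of_sub_of_rep_mem_relations N hNd T fun x hx => by
      rw [hNi (hNd ▸ hx)]; simp only [RFun.fn, hT, aeval_toMvPolynomial]
  -- reduce to dimension one on the cube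
  obtain ⟨a, ha⟩ := exists_reduce_unicoord i q hq T rfl
  set S : RFun 1 := ⟨a, q.toMvPolynomial 0, den_ne_toMvPolynomial_zero q hq⟩ with hS
  obtain ⟨p₁, hp₁⟩ := exists_eq_toMvPolynomial a
  -- restrict the cube `[0,1]` to the open interval
  have hsub : {x : Fin 1 → ℝ | ∀ i, x i ∈ Set.Ioo (0:ℝ) 1} ⊆ S.rep.domain := by
    rw [RFun.rep_domain]; exact box_subset_cube 1
  have h3 : KZ.of S.rep - KZ.of (S.rep.restrict _ (isSemialgebraic_box 1) hsub) ∈ KZ.relations :=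
    KZ.IntegralRep.of_sub_of_restrict_mem_relations S.rep (isSemialgebraic_box 1) hsub
      (by rw [RFun.rep_domain]; exact volume_cube_diff_box 1)
  refine ⟨p₁, S.rep.restrict _ (isSemialgebraic_box 1) hsub,
    by rw [IntegralRep.domain_restrict, box_one_eq], fun x _ => ?_, ?_⟩
  · show S.fn x = _
    rw [RFun.fn_apply, hS, hp₁, aeval_toMvPolynomial, aeval_toMvPolynomial]
  · have e : KZ.of N - KZ.of (S.rep.restrict _ (isSemialgebraic_box 1) hsub) =
        (KZ.of N - KZ.of T.rep) + (KZ.of T.rep - KZ.of S.rep) +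
        (KZ.of S.rep - KZ.of (S.rep.restrict _ (isSemialgebraic_box 1) hsub)) := by abel
    rw [e]
    exact KZ.relations.add_mem (KZ.relations.add_mem g1 ha) h3

end Summit.KontsevichZagierPeriods.HurwitzMicroSectors.NormalFormPrinciple.PiBox.Unicoord
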